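import Summits.QuantumFields.YangMills.Theorems.BalabanUVNodesN08Thm2AtRecordSeamK0
import Summits.QuantumFields.Balaban3D.Proofs.Thm2AC

/-!
# BalabanUVNodes ∕ N08 — [Balaban1985UV3] **THEOREM 2 AS PRINTED ((41), (47) for every k ≤ K) FOR THE DENSITIES OF THE RECORD'S BINDERS** from the
# d = 3 lane's (α)-AC rows read AT THOSE BINDERS (class radius `εbg > 2`), and why this is NOT YET the record's Thm-2 conjunct

Track A, DAG node N08 = T. Bałaban, CMP **102** (1985) 255–275 [Balaban1985UV3]: Thm 2 p. 272 «The sequence of densities ρ_k defined by the inductive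
equations (2), with ρ₀ given by (1), satisfies the inequalities (41), (47).», (41) p. 266, (47) p. 267; (1)–(7) pp. 256–257 (the binders).  Cell `pub-ymgap`,
width seat `pub-ymgap-dag-n08-w1`, W-SEAT-START-LIST §n08 item 1 (file 4); `--supports` K1⁷ `StabilityBAtRecordR13SepCoPH` (helper).

THE INPUT (pub-balaban3d, alpha-1's AC lane, BY IMPORT): `Proofs.Thm2AC.ineq41_47_of_alphaAC` — on the `≤`-family `g²ε₀ ≤ (min γ₀ 1)²`, the AC (α)
rows `AlphaAC.RunAlphaAC 𝔊 𝔠 X 𝔖 𝔄` give (41)_k ∧ (47)_k for every `k ≤ K` on the lane's AC tower `towerOfAC 𝔠.lane X 𝔖` over external inputs `X :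
ExternalInputsAC S G` whose averaging is merely measurable with `Ū_*(dU) ≪ dV` (`AvgAC`) — which PRINT'S OWN averaging (15) on SU(N) satisfies
(`BalabanUVNodesN08Thm2AtRecordBridgeInhabited.avgAC_avOfPrint`), whereas the Haar-compatible `ExternalInputs` of the END theorem are n08-a's seam E6′.

WHAT THIS FILE PROVES (kernel; theorems only; nothing of the paper asserted).
* §1 `towerWithAC_toRunObjects_eq` — the AC twin of `SeamK0.towerWith_toRunObjects_eq`: for `εbg > 2` the lane's stage-1 AC tower objects over inputs
  `D : TowerInputAC` PINNED TO THE RECORD'S BINDERS extend them on the nose.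
* §2 For the lane's AC input `inputOfAC 𝔠.lane (X S) (𝔖 S)` over AC external inputs `X S` whose classes and minimisers are the record's (`reg := bgReg3 …
  εbg`, `U_k := UkA … (k+1) εbg` along `𝔞_X := fun S => (X S).av`), the binders it extends are the record's at the constants
  `c⋆ = (ε₀ := eps0Of γ₀, E := Σ_{j<K} E^{(j)} of the series, b₀, p₀ := the lane's, εbg)` (`inputOfAC_extends_record`), and `c⋆` is ADMISSIBLE (`constsAC_adm`).
* §3 ★★ `thm2_asPrinted_at_record_binders` — **THEOREM 2 AS PRINTED for the densities of the record's binders along `𝔞_X`**: under `RunAlphaAC` at `S`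
  (`≤`-family), there are tower objects `W` with `W.toRunObjects = runObjects₀A N 𝔞_X 𝔗_X (Backgrounds.ofAvg N L 𝔞_X) c⋆ S` — so `W.pin`'s densities ARE
  those binders' `ρ_k = 𝔗^kρ₀` (`SectB.TowerObjects.pin_rho`) — and `B10.Ineq41 W.pin.toTowerRun k ∧ B10.Ineq47 W.pin.toTowerRun k` for every `k ≤ K`; on
  the record's family `Family L c⋆.eps0` this is `B10.Thm2Printed` OF THE PINNED TOWERS (`thm2Printed_pinned_family`), i.e. print's Theorem 2 verbatim
  for those densities.
* §4 THE LOCATED GAP to the record's Thm-2 CONJUNCT `B10.Thm2Printed (runsAtG N R₀ c⋆)`: that conjunct reads the slot `Repr41_47G`, which asks a full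
  `B10Assembly.LeafSystem` on `W.pin.toTowerRun` (Sect. D's large-field control `lf`, (46), (65)'s inputs INCLUDED — `LevelZero` §4: it implies (5) run by
  run); the AC lane supplies (41)∕(47) but NOT `lf` over an AC averaging (`Proofs.Thm2AC` docstring: «Theorem 1 ((5)) is NOT derived here … over `AvgAC` it
  needs a k-fold Jacobian bound, located-unprinted»).  `repr41_47G_of_leafSystem_AC` records the exact upgrade: ONE leaf system on the SAME tower turns
  §3 into the record's conjunct.

HONEST FRAMING: count-neutral helper; N08 NOT discharged; the (α)-AC rows are HYPOTHESES (N08's object gap, class II of n08-b's census) — a LOCATED socket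
(cell rule A6: the binder side is inhabited by `…BridgeInhabited`, the (α) rows are not); `PrintedUV3V` NOT proved; one finite 𝕋⁴ programme at fixed ε,
Bałaban AS PRINTED (d = 3 tori of [B10] inside the record); nothing continuum ∕ ℝ⁴ ∕ OS ∕ mass gap ∕ Clay.  No `sorry`, standard axioms.
-/

noncomputable section

namespace Summit.QuantumFields.YangMills.BalabanUVNodes.N08Thm2AsPrintedAtRecordAC

open Literature.MathematicalPhysics.QuantumFieldTheory.Balaban1983to89
open Literature.MathematicalPhysics.QuantumFieldTheory.Balaban1983to89.Node00 (SU)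
open Literature.MathematicalPhysics.QuantumFieldTheory.Balaban1983to89.B10RunsOfRecord
open Literature.MathematicalPhysics.QuantumFieldTheory.Balaban1985CMP102
open Literature.MathematicalPhysics.QuantumFieldTheory.Balaban1985CMP102.Setting
open Literature.MathematicalPhysics.QuantumFieldTheory.Balaban1985CMP102.Theorems (Family)
open Summit.QuantumFields.Balaban3D
open Summit.QuantumFields.Balaban3D.Carriers (nblkOf StepSeries)
open Summit.QuantumFields.Balaban3D.Proofs
open Summit.QuantumFields.Balaban3D.Proofs.GroupModelLieC (lieC)
open Summit.QuantumFields.Balaban3D.Proofs.Constants (eps0Of)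
open Summit.QuantumFields.YangMills.BalabanUVNodes.N08Thm2AtRecordLevelZero
open Summit.QuantumFields.YangMills.BalabanUVNodes.N08Thm2AtRecordSeamK0

variable {N : ℕ} [NeZero N] {L : ℕ}

/-! ## §1 The AC twin of the binder equation -/
section BinderEq

/-- **The lane's stage-1 AC tower objects over inputs PINNED TO THE RECORD'S BINDERS extend them on the nose, `εbg > 2`** (`TowerInputAC` twin of
`SeamK0.towerWith_toRunObjects_eq`; `U₀`: the lane's `id` = the record's by `SeamK0` §1). [cite: Balaban1985UV3, (1)–(7) pp.256–257 + (38)–(43) p.266 (bookkeeping)] -/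
theorem towerWithAC_toRunObjects_eq (D : ∀ S : Scales L, TowerAC.TowerInputAC S (SU N)) (c : Consts L) (hε : 2 < c.εbg)
    (hε₁ : ∀ (S : Scales L) k, (D S).ε₁ k = eps1OfPrint c S k) (hreg : ∀ (S : Scales L) k, (D S).reg k = bgReg3 N S k c.εbg)
    (hUk : ∀ (S : Scales L) k (V : GaugeField S.P (k + 1) (SU N)), (D S).Uk k V = UkA N (fun S => (D S).av) S (k + 1) c.εbg V)
    (hE : ∀ S : Scales L, B10.Ek (D S).Estep S.K 0 = c.E S) (S : Scales L) :
    ((D S).towerWith fun _ => True).toRunObjects =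
      runObjects₀A N (fun S => (D S).av) (fun S j => (Carriers.run3 ((D S).toRunInput fun _ => True)).T j)
        (Backgrounds.ofAvg N L fun S => (D S).av) c S := by
  have hU : ∀ (k : ℕ) (V : GaugeField S.P k (SU N)),
      (Carriers.run3 ((D S).toRunInput fun _ => True)).Uk k V = UkA N (fun S => (D S).av) S k c.εbg V := by
    intro k V
    cases k with
    | zero => exact (ukA_zero_eq_self_of_two_lt N S (fun S => (D S).av) hε V).symm
    | succ k => exact hUk S k V
  exact runObjects_ext _ _ (hE S) (funext (hε₁ S)) rfl HEq.rfl (funext (hreg S)) (funext fun k => funext (hU k)) rfl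

end BinderEq

/-! ## §2 The lane's AC input at the record's binders: the constants it serves and their admissibility -/
section Lane

variable {𝔊 : GroupModel (SU N)} (𝔠 : Primitives.AlphaConsts L 𝔊.N) (εbg : ℝ)
  (X : ∀ S : Scales L, StandardAC.ExternalInputsAC S (SU N))
  (𝔖 : ∀ (S : Scales L) (k : ℕ), StepSeries S (SU N) ↥(lieC 𝔊) (nblkOf S 𝔠.lane.carrier k) k)

/-- Admissibility of the constants the lane's AC input serves: `ε₀(g) = (min γ₀ 1)²/g² > 0` with `g²ε₀ ≤ 1`, the lane's `b₀ > 0`, `p₀ > 2`, `εbg > 2 > 0`.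
[cite: Balaban1985UV3, p.256 L15–18 + (7) p.257] -/
theorem constsAC_adm (hε : 2 < εbg) (E : Scales L → ℝ) :
    ({ eps0 := eps0Of 𝔠.gamma0, E := E, b₀ := 𝔠.lane.F.b₀, p₀ := 𝔠.lane.F.p₀, εbg := εbg } : Consts L).Adm := by
  refine ⟨fun g hg => ⟨?_, ?_⟩, 𝔠.lane.F.b₀_pos, 𝔠.lane.F.two_lt_p₀, by show (0 : ℝ) < εbg; linarith⟩
  · show 0 < eps0Of 𝔠.gamma0 g
    unfold eps0Of
    have h1 : 0 < min 𝔠.gamma0 1 := lt_min 𝔠.gamma0_pos one_pos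
    positivity
  · show g ^ 2 * eps0Of 𝔠.gamma0 g ≤ 1
    unfold eps0Of
    rw [mul_div_assoc', mul_div_cancel_left₀ _ (pow_ne_zero 2 hg.ne')]
    have h1 : min 𝔠.gamma0 1 ≤ 1 := min_le_right _ _
    have h0 : 0 ≤ min 𝔠.gamma0 1 := (lt_min 𝔠.gamma0_pos one_pos).le
    nlinarith

/-- **The lane's AC input EXTENDS THE RECORD'S BINDERS** at the constants `c⋆ = (eps0Of γ₀, Σ_{j<K}E^{(j)} of the series, lane b₀, lane p₀, εbg)` along
`𝔞_X`, for AC external inputs whose classes and minimisers are the record's and `εbg > 2` (`ε₁ := g_kp(g_k)` agrees by `rfl`). [cite: Balaban1985UV3, (1)–(7) pp.256–257 + (38)–(43) p.266] -/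
theorem inputOfAC_extends_record (hε : 2 < εbg) (hreg : ∀ (S : Scales L) k, (X S).reg k = bgReg3 N S k εbg)
    (hUk : ∀ (S : Scales L) k (V : GaugeField S.P (k + 1) (SU N)), (X S).Uk k V = UkA N (fun S => (X S).av) S (k + 1) εbg V) (S : Scales L) :
    ((InputsAC.inputOfAC 𝔠.lane (X S) (𝔖 S)).towerWith fun _ => True).toRunObjects =
      runObjects₀A N (fun S => (X S).av)
        (fun S j => (Carriers.run3 ((InputsAC.inputOfAC 𝔠.lane (X S) (𝔖 S)).toRunInput fun _ => True)).T j)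
        (Backgrounds.ofAvg N L fun S => (X S).av)
        { eps0 := eps0Of 𝔠.gamma0, E := fun S => B10.Ek (InputsAC.inputOfAC 𝔠.lane (X S) (𝔖 S)).Estep S.K 0,
          b₀ := 𝔠.lane.F.b₀, p₀ := 𝔠.lane.F.p₀, εbg := εbg } S :=
  towerWithAC_toRunObjects_eq (fun S => InputsAC.inputOfAC 𝔠.lane (X S) (𝔖 S))
    { eps0 := eps0Of 𝔠.gamma0, E := fun S => B10.Ek (InputsAC.inputOfAC 𝔠.lane (X S) (𝔖 S)).Estep S.K 0,
      b₀ := 𝔠.lane.F.b₀, p₀ := 𝔠.lane.F.p₀, εbg := εbg }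
    hε (fun _ _ => rfl) (fun S k => hreg S k) (fun S k V => hUk S k V) (fun _ => rfl) S

end Lane

/-! ## §3 THEOREM 2 AS PRINTED for the densities of the record's binders, from the (α)-AC rows at those binders -/
section Thm2

variable {𝔊 : GroupModel (SU N)} {𝔠 : Primitives.AlphaConsts L 𝔊.N} {εbg : ℝ}
  {X : ∀ S : Scales L, StandardAC.ExternalInputsAC S (SU N)}
  {𝔖 : ∀ (S : Scales L) (k : ℕ), StepSeries S (SU N) ↥(lieC 𝔊) (nblkOf S 𝔠.lane.carrier k) k}
  {𝔄 : ∀ S : Scales L, AlphaAC.AlphaDataAC 𝔊 𝔠 (X S) (𝔖 S)}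

/-- ★★ **[Balaban1985UV3] THEOREM 2 AS PRINTED FOR THE DENSITIES OF THE RECORD'S BINDERS, from the d = 3 lane's (α)-AC rows READ AT THOSE BINDERS**
(`εbg > 2`; AC external inputs with the record's classes and minimisers; one lattice approximation of the `≤`-family `g²ε₀ ≤ (min γ₀ 1)²`): there are tower
objects `W` EXTENDING the binders `runObjects₀A N 𝔞_X 𝔗_X (Backgrounds.ofAvg N L 𝔞_X) c⋆ S` — so `W.pin`'s densities are those binders' `ρ_k` — with
(41)_k ∧ (47)_k for every `k ≤ K` (lane `Thm2AC.ineq41_47_of_alphaAC` on `towerOfAC = W.pin.toTowerRun`). [cite: Balaban1985UV3, Thm 2 p.272 + (41) p.266 + (47) p.267] -/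
theorem thm2_asPrinted_at_record_binders (hε : 2 < εbg) (hreg : ∀ (S : Scales L) k, (X S).reg k = bgReg3 N S k εbg)
    (hUk : ∀ (S : Scales L) k (V : GaugeField S.P (k + 1) (SU N)), (X S).Uk k V = UkA N (fun S => (X S).av) S (k + 1) εbg V)
    {S : Scales L} (hle : S.g ^ 2 * S.ε₀ ≤ (min 𝔠.gamma0 1) ^ 2) (R : AlphaAC.RunAlphaAC 𝔊 𝔠 (X S) (𝔖 S) (𝔄 S)) :
    ∃ W : SectB.TowerObjects S (SU N),
      W.toRunObjects = runObjects₀A N (fun S => (X S).av)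
        (fun S j => (Carriers.run3 ((InputsAC.inputOfAC 𝔠.lane (X S) (𝔖 S)).toRunInput fun _ => True)).T j)
        (Backgrounds.ofAvg N L fun S => (X S).av)
        { eps0 := eps0Of 𝔠.gamma0, E := fun S => B10.Ek (InputsAC.inputOfAC 𝔠.lane (X S) (𝔖 S)).Estep S.K 0,
          b₀ := 𝔠.lane.F.b₀, p₀ := 𝔠.lane.F.p₀, εbg := εbg } S ∧
      ∀ k, k ≤ S.K → B10.Ineq41 W.pin.toTowerRun k ∧ B10.Ineq47 W.pin.toTowerRun k :=
  ⟨(InputsAC.inputOfAC 𝔠.lane (X S) (𝔖 S)).towerWith fun _ => True, inputOfAC_extends_record 𝔠 εbg X 𝔖 hε hreg hUk S,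
    fun k hk => Thm2AC.ineq41_47_of_alphaAC hle R k hk⟩

/-- **`B10.Thm2Printed` — print's Theorem 2 verbatim — FOR THE RUN FAMILY OF THE PINNED LANE-AC TOWERS on the record's family `Family L c⋆.eps0`**
(`c⋆.eps0 = eps0Of γ₀`; each member lies on the `≤`-family, `FamilyLE.le_of_eps0Of`), from the (α)-AC rows at every member: the lane's `ineq41_47_of_alphaAC`
read through the pinned slot (`specOK_pin`).  Holds for ANY AC external inputs; when they are pinned to the record's classes and minimisers (`εbg > 2`) these
towers EXTEND the record's binders (`inputOfAC_extends_record`) and their densities ARE the binders' (`towerOfAC_rho_eq`). [cite: Balaban1985UV3, Thm 2 p.272] -/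
theorem thm2Printed_pinned_family
    (R : ∀ S : Family L (eps0Of 𝔠.gamma0), AlphaAC.RunAlphaAC 𝔊 𝔠 (X S.1) (𝔖 S.1) (𝔄 S.1)) :
    B10.Thm2Printed (fun S : Family L (eps0Of 𝔠.gamma0) => (InputsAC.towerOfAC 𝔠.lane (X S.1) (𝔖 S.1)).toRunData) := by
  intro S k hk
  have h := Thm2AC.ineq41_47_of_alphaAC (FamilyLE.le_of_eps0Of S.1 S.2) (R S) k hk
  exact (SectB.TowerObjects.specOK_pin _ k).2 h

/-- The densities of the pinned lane-AC tower ARE those of the record's binders it extends ((2): the slot is not read by `ρ_k`; `pin_rho` + the binder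
equation). [cite: Balaban1985UV3, (2) p.256 (bookkeeping)] -/
theorem towerOfAC_rho_eq (hε : 2 < εbg) (hreg : ∀ (S : Scales L) k, (X S).reg k = bgReg3 N S k εbg)
    (hUk : ∀ (S : Scales L) k (V : GaugeField S.P (k + 1) (SU N)), (X S).Uk k V = UkA N (fun S => (X S).av) S (k + 1) εbg V)
    (S : Scales L) (k : ℕ) :
    (InputsAC.towerOfAC 𝔠.lane (X S) (𝔖 S)).ρ k =
      (runObjects₀A N (fun S => (X S).av)
        (fun S j => (Carriers.run3 ((InputsAC.inputOfAC 𝔠.lane (X S) (𝔖 S)).toRunInput fun _ => True)).T j)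
        (Backgrounds.ofAvg N L fun S => (X S).av)
        { eps0 := eps0Of 𝔠.gamma0, E := fun S => B10.Ek (InputsAC.inputOfAC 𝔠.lane (X S) (𝔖 S)).Estep S.K 0,
          b₀ := 𝔠.lane.F.b₀, p₀ := 𝔠.lane.F.p₀, εbg := εbg } S).rho k := by
  show ((InputsAC.inputOfAC 𝔠.lane (X S) (𝔖 S)).towerWith fun _ => True).pin.rho k = _
  rw [SectB.TowerObjects.pin_rho, ← inputOfAC_extends_record 𝔠 εbg X 𝔖 hε hreg hUk S]

end Thm2

/-! ## §4 The located gap to the record's Thm-2 conjunct: one leaf system on the same tower -/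
section Gap

variable {𝔊 : GroupModel (SU N)} {𝔠 : Primitives.AlphaConsts L 𝔊.N} {εbg : ℝ}
  {X : ∀ S : Scales L, StandardAC.ExternalInputsAC S (SU N)}
  {𝔖 : ∀ (S : Scales L) (k : ℕ), StepSeries S (SU N) ↥(lieC 𝔊) (nblkOf S 𝔠.lane.carrier k) k}

/-- **THE UPGRADE TO THE RECORD'S CONJUNCT IS EXACTLY A LEAF SYSTEM ON THE SAME TOWER**: a `B10Assembly.LeafSystem C` on the pinned lane-AC tower over the
record's binders (Sect. D's `lf`, (46), (65)'s inputs — what the AC lane does not supply) gives the record's ∃-representation reading `Repr41_47G … c⋆ S k` at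
every `k ≤ K` (n08-e's `repr41_47G_of_leafSystem` along `inputOfAC_extends_record`). [cite: Balaban1985UV3, Thm 2 p.272 + Sect. D pp.272–275] -/
theorem repr41_47G_of_leafSystem_AC (hε : 2 < εbg) (hreg : ∀ (S : Scales L) k, (X S).reg k = bgReg3 N S k εbg)
    (hUk : ∀ (S : Scales L) k (V : GaugeField S.P (k + 1) (SU N)), (X S).Uk k V = UkA N (fun S => (X S).av) S (k + 1) εbg V)
    {S : Scales L} {C : B10Assembly.Consts} (LS : B10Assembly.LeafSystem C (InputsAC.towerOfAC 𝔠.lane (X S) (𝔖 S))) (k : ℕ) (hk : k ≤ S.K) :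
    Repr41_47G N (runObjects₀A N (fun S => (X S).av)
        (fun S j => (Carriers.run3 ((InputsAC.inputOfAC 𝔠.lane (X S) (𝔖 S)).toRunInput fun _ => True)).T j)
        (Backgrounds.ofAvg N L fun S => (X S).av))
      { eps0 := eps0Of 𝔠.gamma0, E := fun S => B10.Ek (InputsAC.inputOfAC 𝔠.lane (X S) (𝔖 S)).Estep S.K 0,
        b₀ := 𝔠.lane.F.b₀, p₀ := 𝔠.lane.F.p₀, εbg := εbg } S k :=
  Theorems.BalabanUVNodesN08RelativeTo5.repr41_47G_of_leafSystem N _ _ ((InputsAC.inputOfAC 𝔠.lane (X S) (𝔖 S)).towerWith fun _ => True)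
    (inputOfAC_extends_record 𝔠 εbg X 𝔖 hε hreg hUk S) LS k hk

end Gap

end Summit.QuantumFields.YangMills.BalabanUVNodes.N08Thm2AsPrintedAtRecordAC

end
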